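import Summits.CriticalPhenomena.PercolationContinuityZ3.Theorems.PercNearOneGluingNoHeavyLowerTailThreePointCovBoundary
import HarnessLib

/-!
# Gladkov's three-point continuity conjecture on graphs of bounded total weight: a linear modulus

Support file for crux `stmt-CriticalPhenomena-4575` (`NoHeavyLowerTail`), seat `prim-l12-p1` gen 23 (`--supports`); memo
`run/shared/lean/prim/prim-l12/FROM-prim-l12-p1-g23-COV-BOUNDARY.md` §2.  From the boundary bound `ThreePointCovBoundary.threePointGap_le_boundary`
(`gap ≤ ∑_e w(e)·μ(ab|c ∩ {e joins C(c), C(a)})`) and `μ(ab|c ∩ …) ≤ μ(ab|c)`:  **`gap ≤ (∑_e w(e)) · μ(ab|c)`**, i.e. the conclusion of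
`Consts.ThreePointGapContinuity` (Gladkov 2024, Conj. 10.1) holds UNIFORMLY, with the linear modulus `δ = ε / M`, on every class of finite weighted graphs of total weight
`∑_e w(e) ≤ M`.  (Over ALL graphs no linear modulus exists — fans give `gap/μ(ab|c) → ∞`, memo §3b — so the unrestricted conjecture needs more.)  No definitions, no sorries,
standard axioms.
-/

namespace Summit.CriticalPhenomena.PercolationContinuityZ3.Theorems.ThreePointGapBoundedWeight

open MeasureTheory Set
open Literature.Probability.Percolation Literature.Probability.LatticeModels
open scoped Classical

variable {V : Type*} [Fintype V]

/-- **Linear modulus under bounded total weight**: `μ(a|b|c)·μ(abc) − μ(a alone)·μ(b alone) ≤ (∑_e w(e)) · μ(ab|c)` on every finite weighted graph.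
[cite: Gladkov2024, Conjecture 10.1 (§10)] [this work] -/
theorem threePointGap_le_totalWeight_mul (w : Sym2 V → unitInterval) (a b c : V) :
    (prodBernoulli w).real ((openConn a b)ᶜ ∩ (openConn a c)ᶜ ∩ (openConn b c)ᶜ) *
          (prodBernoulli w).real (openConn a b ∩ openConn a c ∩ openConn b c) -
        (prodBernoulli w).real ((openConn a b)ᶜ ∩ (openConn a c)ᶜ ∩ openConn b c) *
          (prodBernoulli w).real ((openConn b a)ᶜ ∩ (openConn b c)ᶜ ∩ openConn a c) ≤
      (∑ e : Sym2 V, (w e : ℝ)) * (prodBernoulli w).real (openConn a b ∩ (openConn a c)ᶜ ∩ (openConn b c)ᶜ) := by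
  refine (ThreePointCovBoundary.threePointGap_le_boundary w a b c).trans ?_
  rw [Finset.sum_mul]
  refine Finset.sum_le_sum fun e _ => mul_le_mul_of_nonneg_left ?_ (w e).2.1
  exact measureReal_mono inter_subset_left

/-- **Gladkov's Conjecture 10.1 on a bounded-weight class.**  For every `M ≥ 0` and `ε > 0`, with `δ = ε / (M + 1)`: on every finite weighted graph of total weight
`∑_e w(e) ≤ M`, `μ(ab|c) < δ` implies `μ(a|b|c)μ(abc) − μ(a alone)μ(b alone) < ε` — the statement of `Consts.ThreePointGapContinuity` restricted to the class,
with an explicit linear modulus. [cite: Gladkov2024, Conjecture 10.1 (§10)] [this work] -/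
theorem threePointGapContinuity_of_totalWeight_le (M : ℝ) (hM : 0 ≤ M) (ε : ℝ) (hε : 0 < ε) :
    ∃ δ : ℝ, 0 < δ ∧ ∀ (n : ℕ) (w : Sym2 (Fin n) → unitInterval) (a b c : Fin n), (∑ e : Sym2 (Fin n), (w e : ℝ)) ≤ M →
      (prodBernoulli w).real ((openConn c a)ᶜ ∩ (openConn c b)ᶜ ∩ openConn a b) < δ →
        (prodBernoulli w).real ((openConn a b)ᶜ ∩ (openConn a c)ᶜ ∩ (openConn b c)ᶜ) *
              (prodBernoulli w).real (openConn a b ∩ openConn a c ∩ openConn b c) -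
            (prodBernoulli w).real ((openConn a b)ᶜ ∩ (openConn a c)ᶜ ∩ openConn b c) *
              (prodBernoulli w).real ((openConn b a)ᶜ ∩ (openConn b c)ᶜ ∩ openConn a c) < ε := by
  refine ⟨ε / (M + 1), div_pos hε (by linarith), fun n w a b c hW hs => ?_⟩
  have h := threePointGap_le_totalWeight_mul w a b c
  have hs' : (prodBernoulli w).real (openConn a b ∩ (openConn a c)ᶜ ∩ (openConn b c)ᶜ) < ε / (M + 1) := by
    have : (openConn a b ∩ (openConn a c)ᶜ ∩ (openConn b c)ᶜ : Set (BondConfig (Fin n))) = (openConn c a)ᶜ ∩ (openConn c b)ᶜ ∩ openConn a b := by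
      rw [KNPreFKG.openConn_symm c a, KNPreFKG.openConn_symm c b]; ext ω; simp only [mem_inter_iff]; tauto
    rw [this]; exact hs
  have hsum : 0 ≤ ∑ e : Sym2 (Fin n), (w e : ℝ) := Finset.sum_nonneg fun e _ => (w e).2.1
  have hs0 : 0 ≤ (prodBernoulli w).real (openConn a b ∩ (openConn a c)ᶜ ∩ (openConn b c)ᶜ) := measureReal_nonneg
  calc _ ≤ (∑ e : Sym2 (Fin n), (w e : ℝ)) * (prodBernoulli w).real (openConn a b ∩ (openConn a c)ᶜ ∩ (openConn b c)ᶜ) := h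
    _ ≤ M * (ε / (M + 1)) := mul_le_mul hW hs'.le hs0 hM
    _ < ε := by
        rw [mul_div_assoc']
        rw [div_lt_iff₀ (by linarith)]
        nlinarith
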